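import Summits.HodgeConjecture.HodgeConjecture.Theorems.MarkmanPartnerTransportPicardThreeK3SquaresCycleInducedSector
import Summits.HodgeConjecture.HodgeConjecture.Theses.MarkmanPartnerTransport
import Literature.AlgebraicGeometry.HodgeTheory.HodgeClassOfMorphismDischarge
import Literature.AlgebraicGeometry.HodgeTheory.ComplexGysinCorrespondence
import Literature.AlgebraicGeometry.Surfaces.K3Marking

/-!
# Route MarkmanPartnerTransport · crux `PicardThreeK3Squares` (stmt-HodgeConjecture-19652) —
# Varesco's equivalence: HC for `S × S` ⟺ `End_Hdg(T(S))` consists of algebraic correspondences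

`Theorems/…CycleInducedSector` proves the direction ⟸ of Varesco's bookkeeping "proving the Hodge
conjecture for `X²` is equivalent to showing that every element of `End_Hdg(T(X))` is algebraic"
(Varesco 2023, §2 p. 8) for every smooth projective complex surface, in the form of the CYCLE-INDUCED
SECTOR CLAUSE: every rational Hodge endomorphism of `H²(S(ℂ); ℂ)` killing `N¹` with image in
`T = (N¹)^⊥` agrees on `T` with an `N¹`-stable endomorphism induced by an algebraic class on `S × S`.
This file proves the direction ⟹ and records the equivalence, so that the crux `PicardThreeK3Squares`
is pinned to ONE statement about endomorphism algebras of transcendental lattices: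

* `cycleInducedSector_of_hodgeConjectureFor_square` — if `HodgeConjectureFor 4 (S ⊗ S)` then the
  clause holds, for every orientation family: a rational type-preserving `f` is `t • [γ]_*`, `t ≠ 0`,
  for a RATIONAL `(2,2)`-class `γ` on `S × S` (Voisin I Lemma 11.41, the tree's discharged
  `exists_hodgeClass_corrAction_eq_smul_holds`), `γ` is algebraic by HC, and `f = [t⁻¹ γ]_*` kills `N¹`.
* `hodgeConjectureFor_square_iff_cycleInducedSector` — the equivalence, for every smooth projective
  surface and orientation family.
* `cycleInducedSector_of_picardThreeK3Squares` — the crux implies the clause for every projective K3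
  surface with `ρ(S) ≥ 3` (markings by `Huybrechts_K3_marking_exists`); with
  `CMThird.picardThreeK3Squares_of_realMultiplicationThird` (the converse on the RM third, mod Buskin's
  Thm. 1.1 and markings) the crux is EQUIVALENT, modulo those named facts, to the clause on non-CM,
  non-scalar K3 surfaces of Picard rank `≥ 3`.

No definition, no sorry. Prover seat hodge-nonav-19652-p1 (gen 0), `--supports stmt-HodgeConjecture-19652`.

References: Varesco (2023), §2 p. 8; Voisin, *Hodge Theory and Complex Algebraic Geometry I*, §11.3.3
Thm. 11.38 and Lemma 11.41.
-/

set_option linter.dupNamespace false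

noncomputable section

namespace Summit.HodgeConjecture.HodgeConjecture.Theorems.MarkmanPartnerTransport.SectorIff

open scoped Manifold
open CategoryTheory MonoidalCategory CartesianMonoidalCategory
open Literature.AlgebraicGeometry Literature.AlgebraicGeometry.Motives Literature.AlgebraicGeometry.HodgeTheory
open Literature.AlgebraicGeometry.Surfaces
open Literature.AlgebraicTopology.SingularHomology
open Summit.HodgeConjecture.HodgeConjecture.Theorems.MarkmanPartnerTransport.CycleInducedSector

variable {S : SchemeOver ℂ}

/-- `Corr[μ, hS ; γ, y] = pr₁_*(pr₂^* y ∪ γ)` on `H²(S(ℂ); ℂ)`. Local notation only. -/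
local notation3 (prettyPrint := false) "Corr[" μ ", " hS " ; " γ ", " y "]" =>
  complexGysin μ (IsSmoothProjective.tensor_holds hS hS) hS
    (SemiCartesianMonoidalCategory.fst _ _) (rfl : 2 * 1 + 2 * 2 + 2 * 2 = 2 * 1 + 2 * (2 + 2))
    (cupProduct (rfl : 2 * 1 + 2 * 2 = 2 * 1 + 2 * 2)
      (complexBetti.map (SemiCartesianMonoidalCategory.snd _ _) (2 * 1) y) γ)

/-! ### HC for `S × S` ⟹ the cycle-induced sector clause -/

/-- **If the Hodge conjecture holds for `S ⊗ S`, every rational Hodge endomorphism of `H²(S)` killing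
`N¹` is induced by an algebraic class on `S × S`** — so the cycle-induced sector clause holds (with
`g := f`), for every smooth projective surface `S` and orientation family `μ`. By Voisin I Lemma 11.41
(`exists_hodgeClass_corrAction_eq_smul_holds`) a rational type-preserving `f` is `t • [γ]_*` with
`t ≠ 0` and `γ` a rational `(2,2)`-class; `γ` is algebraic by `HodgeConjectureFor 4 (S ⊗ S)` in
codimension `2`; `f = [t⁻¹ γ]_*`. [cite: Varesco2023, §2 (p. 8)]
[cite: VoisinHodgeI2002, §11.3.3 Thm. 11.38 and Lemma 11.41] -/
theorem cycleInducedSector_of_hodgeConjectureFor_square (μ : OrientationFamily)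
    (hS : IsSmoothProjective 2 S) (hHC : HodgeConjectureFor 4 (S ⊗ S)) :
    ∀ (f : complexBetti S (2 * 1) →ₗ[ℂ] complexBetti S (2 * 1)),
      (∀ y, IsRationalClass y → IsRationalClass (f y)) →
      (∀ (i j : ℕ) y, IsOfHodgeType 2 S (2 * 1) i j y → IsOfHodgeType 2 S (2 * 1) i j (f y)) →
      (∀ d ∈ algebraicClasses S 1, f d = 0) →
      (∀ y : complexBetti S (2 * 1), ∀ d ∈ algebraicClasses S 1,
        cupProduct (rfl : 2 * 1 + 2 * 1 = 2 * 2) (f y) d = 0) →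
      ∃ g : complexBetti S (2 * 1) →ₗ[ℂ] complexBetti S (2 * 1),
        (∀ d ∈ algebraicClasses S 1, g d ∈ algebraicClasses S 1) ∧
        (∃ γ ∈ algebraicClasses (S ⊗ S) 2, ∀ y : complexBetti S (2 * 1), g y = Corr[μ, hS ; γ, y]) ∧
        ∀ y : complexBetti S (2 * 1),
          (∀ d ∈ algebraicClasses S 1, cupProduct (rfl : 2 * 1 + 2 * 1 = 2 * 2) y d = 0) →
            f y = g y := by
  intro f hf_rat hf_typ hf_N _
  have hI := hodgePQ_independent_of_hodgeModel_holds
  obtain ⟨A⟩ := nonempty_hodgeModel_holds (n := 2) (X := S) hS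
  -- Voisin I, Lemma 11.41: `f = t⁻¹ • γ_*` for a rational `(2,2)`-class `γ`
  obtain ⟨γ, hγQ, hγT, t, ht0, hγ⟩ := exists_hodgeClass_corrAction_eq_smul_holds hS hS A A
    (a := 2 * 1) (b := 2 * 1) (e := 2) (r := 0) (rfl : 2 * 1 + 2 * 2 = 2 * 1 + 2 * 2)
    (rfl : 2 + 0 = 2) f hf_rat
    (fun p q _ c hc ↦ by
      rw [Nat.add_zero, Nat.add_zero]
      exact (hI.isOfHodgeType_iff hS A).1 (hf_typ p q c ((hI.isOfHodgeType_iff hS A).2 hc))) μ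
  -- `γ` is algebraic by the Hodge conjecture for `S ⊗ S` in codimension `2`
  have hγalg : γ ∈ algebraicClasses (S ⊗ S) 2 := hHC.2 2 γ hγQ hγT
  refine ⟨f, fun d hd ↦ ?_, ⟨t⁻¹ • γ, Submodule.smul_mem _ _ hγalg, fun y ↦ ?_⟩, fun y _ ↦ rfl⟩
  · rw [hf_N d hd]
    exact Submodule.zero_mem _
  · have h := LinearMap.congr_fun hγ y
    rw [LinearMap.smul_apply, corrAction_apply] at h
    rw [map_smul, map_smul, h, smul_smul, inv_mul_cancel₀ ht0, one_smul]

/-- **Varesco's equivalence, for every smooth projective complex surface**: the Hodge conjecture for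
`S ⊗ S` holds if and only if every rational Hodge endomorphism of `H²(S(ℂ); ℂ)` killing `N¹H²` with
image in `T = (N¹)^⊥` agrees on `T` with an `N¹`-stable endomorphism induced by an algebraic class on
`S × S` ("HC for `X²` ⟺ every element of `End_Hdg(T(X))` is algebraic"):
`hodgeConjectureFor_square_of_cycleInducedSector` and
`cycleInducedSector_of_hodgeConjectureFor_square`. [cite: Varesco2023, §2 (p. 8)]
[cite: VoisinHodgeI2002, §11.3.3 Lemma 11.41] -/
theorem hodgeConjectureFor_square_iff_cycleInducedSector (μ : OrientationFamily)
    (hS : IsSmoothProjective 2 S) :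
    HodgeConjectureFor 4 (S ⊗ S) ↔
      ∀ (f : complexBetti S (2 * 1) →ₗ[ℂ] complexBetti S (2 * 1)),
        (∀ y, IsRationalClass y → IsRationalClass (f y)) →
        (∀ (i j : ℕ) y, IsOfHodgeType 2 S (2 * 1) i j y → IsOfHodgeType 2 S (2 * 1) i j (f y)) →
        (∀ d ∈ algebraicClasses S 1, f d = 0) →
        (∀ y : complexBetti S (2 * 1), ∀ d ∈ algebraicClasses S 1,
          cupProduct (rfl : 2 * 1 + 2 * 1 = 2 * 2) (f y) d = 0) →
        ∃ g : complexBetti S (2 * 1) →ₗ[ℂ] complexBetti S (2 * 1),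
          (∀ d ∈ algebraicClasses S 1, g d ∈ algebraicClasses S 1) ∧
          (∃ γ ∈ algebraicClasses (S ⊗ S) 2, ∀ y : complexBetti S (2 * 1),
            g y = Corr[μ, hS ; γ, y]) ∧
          ∀ y : complexBetti S (2 * 1),
            (∀ d ∈ algebraicClasses S 1, cupProduct (rfl : 2 * 1 + 2 * 1 = 2 * 2) y d = 0) →
              f y = g y :=
  ⟨cycleInducedSector_of_hodgeConjectureFor_square μ hS, hodgeConjectureFor_square_of_cycleInducedSector μ hS⟩

/-! ### The crux implies the clause on its sector -/

/-- **`PicardThreeK3Squares` implies the cycle-induced sector clause for every projective K3 surface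
of Picard rank `≥ 3`** (markings from `Huybrechts_K3_marking_exists`, whose clause is VERBATIM the
crux's marking hypothesis). Together with `CMThird.picardThreeK3Squares_of_realMultiplicationThird`,
the crux is equivalent — modulo Buskin's Thm. 1.1 and the existence of markings — to this clause on
the non-CM, non-scalar (real-multiplication) K3 surfaces with `ρ(S) ≥ 3`. [cite: Varesco2023, §2 (p. 8)] -/
theorem cycleInducedSector_of_picardThreeK3Squares
    (h : Summit.HodgeConjecture.HodgeConjecture.Theses.MarkmanPartnerTransport.PicardThreeK3Squares)
    (hmark : Huybrechts_K3_marking_exists) (μ : OrientationFamily) (S : SchemeOver ℂ)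
    (hS : IsK3Surface S) (hρ : 3 ≤ Module.finrank ℂ ↥(algebraicClasses S 1)) :
    ∀ (f : complexBetti S (2 * 1) →ₗ[ℂ] complexBetti S (2 * 1)),
      (∀ y, IsRationalClass y → IsRationalClass (f y)) →
      (∀ (i j : ℕ) y, IsOfHodgeType 2 S (2 * 1) i j y → IsOfHodgeType 2 S (2 * 1) i j (f y)) →
      (∀ d ∈ algebraicClasses S 1, f d = 0) →
      (∀ y : complexBetti S (2 * 1), ∀ d ∈ algebraicClasses S 1,
        cupProduct (rfl : 2 * 1 + 2 * 1 = 2 * 2) (f y) d = 0) →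
      ∃ g : complexBetti S (2 * 1) →ₗ[ℂ] complexBetti S (2 * 1),
        (∀ d ∈ algebraicClasses S 1, g d ∈ algebraicClasses S 1) ∧
        (∃ γ ∈ algebraicClasses (S ⊗ S) 2, ∀ y : complexBetti S (2 * 1),
          g y = Corr[μ, hS.isSmoothProjective ; γ, y]) ∧
        ∀ y : complexBetti S (2 * 1),
          (∀ d ∈ algebraicClasses S 1, cupProduct (rfl : 2 * 1 + 2 * 1 = 2 * 2) y d = 0) →
            f y = g y := by
  obtain ⟨η, p, x, hM⟩ := hmark S hS
  exact cycleInducedSector_of_hodgeConjectureFor_square μ hS.isSmoothProjective (h S hS η p x hM hρ)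

end Summit.HodgeConjecture.HodgeConjecture.Theorems.MarkmanPartnerTransport.SectorIff

end
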